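import Summits.Ventures.HSemireg.ComponentLadderG2n
import Summits.Ventures.HSemireg.WeilFamilyReachHyperbolicOfSimilar
import Summits.HodgeConjecture.HodgeConjecture.Theorems.Ring2HypothesesWeilTypeGeneralDischarged
import Summits.HodgeConjecture.HodgeConjecture.Theorems.Ring2TransportWeilTypeGeneralDischarged
import HarnessLib

/-!
# Venture HSemireg — the component ladder, COMPONENT-FREE and at COFINAL levels: ONE seed on ANY Weil-type member at level `N` decides
# every level `1 ≤ n < N`; seeded members (on ANY components) at cofinal levels decide R∞ `WeilClassesImaginaryQuadratic` and, with the
# Moonen–Zarhin reduction BY NAME, seat p5's «consequences» tower — the (S4)-shape existence clause WEAKENED from split to arbitrary anchors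

HONEST FRAMING. Assembly leaf of a COMPUTATION cell (`pub-hsemireg`, Sunday typer seat p11 «assembly, g = 2n», third generation; companion
of `ComponentLadderG2n.lean`). Every published input is a hypothesis BY NAME (`weilFamilyReach_similar`, Deligne, REFEREED named fact; the
door-agnostic transfer statement `LocalVariationalHodgeFor 𝒪`; in §3 the Moonen–Zarhin reduction
`MoonenZarhin1999_hodgeClasses_abelian_dim_le_five_of_weilClassesFourfolds`), every object a hypothesis BY VALUE (seeds of class `𝒪` on
Weil-type members); nothing here says HC, HC_CM or HC_AV is proved, and by the signed verdict (`target-g6/VERDICT-G6.md` v1.0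
`1651dcc7322662a2`) NO census row supplies a seed on any deciding component. 0 `sorry`, 0 `def`, 0 new named fact.

## What is typed

§1 COMPONENT-FREE member form (`below_of_localVariationalHodgeFor_of_seedOn_weilType`): the polarized member's discriminant class `δ` need not
   be named — every `K`-symmetrised hyperplane class of a Weil-type `(N, d)` pair HAS a non-degenerate class (van Geemen Lemma 5.2 (1)–(3),
   tree theorem `VanGeemen1994.exists_hasWeilDiscriminantNondeg`) — so: reach-by-similitude ∧ `LocalVariationalHodgeFor 𝒪` ∧ ONE seed of
   class `𝒪` on ANY `(P, ψ₀)` of Weil type `(N, d)` in the class `h_K = symmetrisedClass d P ψ₀ e a` ⟹ every component `(n, d, δ')` and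
   `WeilAlgebraicAll n d` for every `1 ≤ n < N`. The split seed of the companions (`HasHyperbolicSeedOn 𝒪 N d`) is the special case of a
   hyperbolic member (`hasSeededWeilTypeMember_of_hasHyperbolicSeedOn`, Deligne–van Geemen «hyperbolic ⟹ Weil type», tree theorem).
§2 COFINAL LEVELS ⟹ R∞: if for every `n ≥ 2` and every `d` SOME level `N > n` carries a seeded Weil-type member for `ℚ(√-d)` — on a split OR a
   non-split component — then `WeilTypeLadder.WeilClassesImaginaryQuadratic` (Weil 1977's question for imaginary quadratic `K`); per column
   `K = ℚ(√-d)`: `WeilAlgebraicAll n d` for every `n ≥ 1`. Seat p5's `…_of_cofinalHyperbolicSeedsOn` (MarkmanClassStatementTower §2) is the same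
   sentence with SPLIT anchors and `weilFamilyReach_hyperbolic`; here the anchors are arbitrary and the reach fact is `weilFamilyReach_similar`.
   In STRUCTURE's words: the OPEN existence clause (S4) may be witnessed on ANY component, not only on `(n, K, (−1)ⁿ·Nm)`.
§3 TERMINUS: F1 (Markman's fourfold statement, in print) ∧ — Moonen–Zarhin BY NAME — HC(dim ≤ 5) from ONE seeded member of ANY ℚ(√-d)-Weil
   SIXFOLD component per `d` (level 3 alone); R1 = stmt-2524 `WeilSixfolds` ∧ R1′ `NonsplitSixfolds` from ONE seeded member of ANY ℚ(√-d)-Weil EIGHTFOLD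
   component per `d` (level 4 alone; p5's Tower level-3 ∕ level-4 sentences need SPLIT anchors; p5's `MarkmanClassStatementComponent` §2 ∕ §7 already
   reads ANY component over `weilFamilyReach_similar` at the anchor's OWN level — the DESCENT below `N` is what is new); and from cofinal levels p5's whole
   tower, re-derived from R∞ by the ring-2 ladder's ON-PATH arrows (`WeilTypeLadderOnPath`, the arrows p5's Tower §4 composes): F1, R1, R1′, R2
   `SplitWeilAbelianVarieties`, HC(dim ≤ 5) as an implication. NOT `HC_AV`.
§4 ONE REACH FACT: by `WeilFamilyReachHyperbolicOfSimilar.lean` (`weilFamilyReach_similar → weilFamilyReach_hyperbolic`, tree theorems only) the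
   companions' SPLIT-anchored sentences — p7 ∕ p11 g0's level-`N` ladder, p11 g0's § g = 8 conjunction and (S4) reading, p5's tower — hold BY NAME over
   `weilFamilyReach_similar` ALONE, the reach fact of the deciding-row forms: the assembly's trust base has one reach fact, not two.
§5 BEYOND DIMENSION 5 — the GENERAL members (van Geemen Thm. 6.12 = ring 2's binder-free kernel theorems; the arrow s4-bridge-3's (B3-e) re-exposes): a seeded member of
   ANY component `(N, d, δ)` ⟹ HC for every GENERAL Weil-type member (`Hg = SU_H`) of that component and of every component `(n, d, δ')`, `n < N`;
   cofinal seeded members ⟹ `Ring2Transport.HodgeGeneralWeilType` — HC for EVERY general abelian variety of Weil type with imaginary quadratic `K`,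
   in every dimension. Special members (CM points, `Hg ⊊ SU_H`), CM fields of degree > 2 and `HC_AV` are NOT reached.

References: [Schoen1998HodgeWeilAddendum] ¶10; [Deligne1982HodgeCycles] §4 Cor. 4.2, proof of Thm. 4.8; [vanGeemen1994HodgeAV] 4.9, 4.14, 5.2–5.5, Thm. 6.11–6.12;
[Weil1977HodgeRing] §3; [Markman2025SurveySecant] arXiv:2509.23403 §4, §11.5, §12, Thm. 1.2, Cor. 1.3 (preprint); [MoonenZarhin1999LowDim] Thms. 0.1–0.2. -/

noncomputable section

open CategoryTheory CategoryTheory.Limits AlgebraicGeometry Set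
open Literature.AlgebraicGeometry Literature.AlgebraicGeometry.Motives Literature.AlgebraicGeometry.Modules
open Literature.AlgebraicGeometry.HodgeTheory Literature.AlgebraicGeometry.KTheory
open Literature.AlgebraicGeometry.ModuliOfAbelianVarieties Literature.AlgebraicGeometry.Deligne1982
open Literature.AlgebraicGeometry.VanGeemen1994
open Literature.AlgebraicTopology.SingularHomology

namespace Summit.Ventures.HSemireg

open Summit.HodgeConjecture.HodgeConjecture
open Summit.HodgeConjecture.HodgeConjecture.WeilTypeLadder
open Summit.HodgeConjecture.HodgeConjecture.Cruxes.HodgeAbelianVarieties.EStepSecantInduction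
open Summit.HodgeConjecture.HodgeConjecture.Ring2.Hypotheses
open Summit.HodgeConjecture.HodgeConjecture.Ring2.AbelianAll
open Summit.Ventures.HSemireg.GeneralStructure
open Summit.Ventures.HSemireg.FormulaN.Uniform (S4Conjecture)

/-! ## §1 Component-free member form: the member's discriminant class need not be named -/

section ComponentFree

variable {𝒪 : ObjClass}

/-- **ONE seed on ANY Weil-type member at level `N` decides every level below — component-free form.** BY NAME: `weilFamilyReach_similar`
(REFEREED) and `LocalVariationalHodgeFor 𝒪`. BY VALUE: `(P, ψ₀)` of Weil type `(N, d)` (van Geemen 4.9), a projective embedding `e` and a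
rational `a ≠ 0` (the class `h_K = d·e^*a + ψ₀^*e^*a`), a non-zero rational Weil class `w`, ONE seed of class `𝒪` on `(P, h_K, w)`.
CONCLUSION: for every `1 ≤ n < N`, every component `(n, d, δ')` and `WeilAlgebraicAll n d`. The member's own discriminant class exists by
van Geemen Lemma 5.2 (1)–(3) (`exists_hasWeilDiscriminantNondeg`, tree theorem) and `ComponentLadderG2n`'s ladder applies in it.
[cite: vanGeemen1994HodgeAV, Lemma 5.2 (1)–(4)] [cite: Schoen1998HodgeWeilAddendum, 10 (Proposition), p. 332]
[cite: Deligne1982HodgeCycles, proof of Thm. 4.8] -/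
theorem below_of_localVariationalHodgeFor_of_seedOn_weilType (hF : weilFamilyReach_similar) (hT : LocalVariationalHodgeFor 𝒪)
    {N d : ℕ} {P : AbelianVariety ℂ} {ψ₀ : P ⟶ P} (hW : IsWeilType P ψ₀ N d) (e : ProjectiveEmbedding P.X)
    {a : complexBetti (projectiveSpace e.n ℂ) 2} (haQ : IsRationalClass a) (ha0 : a ≠ 0)
    {w : complexBetti P.X (2 * N)} (hwW : w ∈ weilClassesOf P ψ₀ N d) (hwQ : IsRationalClass w) (hw0 : w ≠ 0)
    (hS : HasSeedOn 𝒪 N P (symmetrisedClass d P ψ₀ e a) w) :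
    (∀ n : ℕ, 0 < n → n < N → ∀ δ' : weilNormResidueGroup d, WeilClassesComponent n d δ') ∧
      ∀ n : ℕ, 0 < n → n < N → WeilAlgebraicAll n d := by
  obtain ⟨δ, hδ⟩ := exists_hasWeilDiscriminantNondeg hW.pos hW.dim_eq hW.d_pos hW.sq_eq e haQ ha0
  exact (componentLadder_of_localVariationalHodgeFor_of_seedOn_member hF hT hW e haQ ha0 hδ hwW hwQ hw0 hS).2

/-- **The companions' SPLIT seed is a special case**: a hyperbolic seed of class `𝒪` at level `N` for `ℚ(√-d)` (`HasHyperbolicSeedOn 𝒪 N d`: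
a split anchor in the `K`-symmetrised class with a seed) IS a seeded Weil-type member in the sense of this file — «hyperbolic ⟹ Weil type»
(tree theorem `isWeilType_of_isHyperbolicWeilType`). [cite: Deligne1982HodgeCycles, proof of Thm. 4.8 with Prop. 4.4] [cite: vanGeemen1994HodgeAV, Lemma 5.2 (1) and 5.4] -/
theorem hasSeededWeilTypeMember_of_hasHyperbolicSeedOn {N d : ℕ} (hN : 0 < N) (hd : 0 < d) (hS : HasHyperbolicSeedOn 𝒪 N d) :
    ∃ (P : AbelianVariety ℂ) (ψ₀ : P ⟶ P) (e : ProjectiveEmbedding P.X) (a : complexBetti (projectiveSpace e.n ℂ) 2)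
      (w : complexBetti P.X (2 * N)),
      IsWeilType P ψ₀ N d ∧ IsRationalClass a ∧ a ≠ 0 ∧ w ∈ weilClassesOf P ψ₀ N d ∧ IsRationalClass w ∧ w ≠ 0 ∧
        HasSeedOn 𝒪 N P (symmetrisedClass d P ψ₀ e a) w := by
  obtain ⟨P, ψ₀, e, a, w, hP, hψ, ha, ha0, hhyp, hwW, hwQ, hw0, hSeed⟩ := hS
  exact ⟨P, ψ₀, e, a, w, isWeilType_of_isHyperbolicWeilType hN hd hP hψ e ha ha0 hhyp, ha, ha0, hwW, hwQ, hw0, hSeed⟩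

end ComponentFree

/-! ## §2 Cofinal levels of seeded members (ANY components) ⟹ R∞; one column `K = ℚ(√-d)` -/

section Cofinal

variable {𝒪 : ObjClass}

/-- **One column `K = ℚ(√-d)`: seeded Weil-type members at COFINAL levels ⟹ `WeilAlgebraicAll n d` for EVERY `n ≥ 1`** (every rational
`(n,n)` Weil class of every `(A, φ)` with `φ ≫ φ = -d`, every discriminant). BY NAME `weilFamilyReach_similar`, `LocalVariationalHodgeFor 𝒪`;
BY VALUE, for every `n ≥ 1`, SOME level `N > n` with a seeded Weil-type member for `d` (on any component). No census column supplies this.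
[cite: Schoen1998HodgeWeilAddendum, 10 (Proposition), p. 332] [cite: Markman2025SurveySecant, §4 and §12 (preprint)] [cite: Deligne1982HodgeCycles, proof of Thm. 4.8] -/
theorem weilAlgebraicAll_of_reach_of_localVariationalHodgeFor_of_cofinalSeededMembers_column (hF : weilFamilyReach_similar)
    (hT : LocalVariationalHodgeFor 𝒪) {d : ℕ}
    (hS : ∀ n : ℕ, 0 < n → ∃ (N : ℕ) (P : AbelianVariety ℂ) (ψ₀ : P ⟶ P) (e : ProjectiveEmbedding P.X)
      (a : complexBetti (projectiveSpace e.n ℂ) 2) (w : complexBetti P.X (2 * N)),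
      n < N ∧ IsWeilType P ψ₀ N d ∧ IsRationalClass a ∧ a ≠ 0 ∧ w ∈ weilClassesOf P ψ₀ N d ∧ IsRationalClass w ∧ w ≠ 0 ∧
        HasSeedOn 𝒪 N P (symmetrisedClass d P ψ₀ e a) w)
    {n : ℕ} (hn : 0 < n) : WeilAlgebraicAll n d := by
  obtain ⟨N, P, ψ₀, e, a, w, hnN, hW, haQ, ha0, hwW, hwQ, hw0, hSeed⟩ := hS n hn
  exact (below_of_localVariationalHodgeFor_of_seedOn_weilType hF hT hW e haQ ha0 hwW hwQ hw0 hSeed).2 n hn hnN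

/-- **… and every CELL `(n, K, δ)`, `n ≥ 1`, of that column.** [cite: vanGeemen1994HodgeAV, 4.14 and Lemma 5.2] [cite: Schoen1998HodgeWeilAddendum, 10 (Proposition), p. 332] -/
theorem weilClassesComponent_of_reach_of_localVariationalHodgeFor_of_cofinalSeededMembers_column (hF : weilFamilyReach_similar)
    (hT : LocalVariationalHodgeFor 𝒪) {d : ℕ}
    (hS : ∀ n : ℕ, 0 < n → ∃ (N : ℕ) (P : AbelianVariety ℂ) (ψ₀ : P ⟶ P) (e : ProjectiveEmbedding P.X)
      (a : complexBetti (projectiveSpace e.n ℂ) 2) (w : complexBetti P.X (2 * N)),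
      n < N ∧ IsWeilType P ψ₀ N d ∧ IsRationalClass a ∧ a ≠ 0 ∧ w ∈ weilClassesOf P ψ₀ N d ∧ IsRationalClass w ∧ w ≠ 0 ∧
        HasSeedOn 𝒪 N P (symmetrisedClass d P ψ₀ e a) w)
    {n : ℕ} (hn : 0 < n) (δ : weilNormResidueGroup d) : WeilClassesComponent n d δ :=
  weilClassesComponent_of_weilAlgebraicAll
    (weilAlgebraicAll_of_reach_of_localVariationalHodgeFor_of_cofinalSeededMembers_column hF hT hS hn) δ

/-- **R∞ `WeilClassesImaginaryQuadratic` ⟸ reach-by-similitude ∧ `LocalVariationalHodgeFor 𝒪` ∧ COFINAL seeded members on ANY components**: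
for every `n ≥ 2` and every `d > 0` SOME level `N > n` carries a Weil-type `(N, d)` pair with a seed of class `𝒪` in a `K`-symmetrised
hyperplane class (split OR non-split; the discriminant class is not in the data). Compare seat p5's
`weilClassesImaginaryQuadratic_of_reach_of_localVariationalHodgeFor_of_cofinalHyperbolicSeedsOn` (SPLIT anchors, hyperbolic reach): the
object-side clause is weakened from `HasHyperbolicSeedOn` to any seeded Weil-type member (§1's `hasSeededWeilTypeMember_of_hasHyperbolicSeedOn`),
the reach fact is Deligne's by-similitude form. The honest terminus of the cell's strategy read uniformly in the level and the component;
NOT `HC_AV`. Nothing is claimed: by the signed verdict the census supplies seeded members only at `N ≤ 3` and only on SPLIT components (method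
instances, print territory) — nothing cofinal, nothing on a deciding component. [cite: Weil1977HodgeRing, §3]
[cite: Markman2025SurveySecant, §4, §11.5 Steps 1–2 and §12 (preprint)] [cite: Schoen1998HodgeWeilAddendum, 10 (Proposition), p. 332]
[cite: Deligne1982HodgeCycles, proof of Thm. 4.8] -/
theorem weilClassesImaginaryQuadratic_of_reach_of_localVariationalHodgeFor_of_cofinalSeededMembers (hF : weilFamilyReach_similar)
    (hT : LocalVariationalHodgeFor 𝒪)
    (hS : ∀ n : ℕ, 2 ≤ n → ∀ d : ℕ, 0 < d → ∃ (N : ℕ) (P : AbelianVariety ℂ) (ψ₀ : P ⟶ P) (e : ProjectiveEmbedding P.X)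
      (a : complexBetti (projectiveSpace e.n ℂ) 2) (w : complexBetti P.X (2 * N)),
      n < N ∧ IsWeilType P ψ₀ N d ∧ IsRationalClass a ∧ a ≠ 0 ∧ w ∈ weilClassesOf P ψ₀ N d ∧ IsRationalClass w ∧ w ≠ 0 ∧
        HasSeedOn 𝒪 N P (symmetrisedClass d P ψ₀ e a) w) :
    WeilClassesImaginaryQuadratic := by
  intro n hn d hd A φ hA _ hφ c hc hnn hcW
  obtain ⟨N, P, ψ₀, e, a, w, hnN, hW, haQ, ha0, hwW, hwQ, hw0, hSeed⟩ := hS n hn d hd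
  exact (below_of_localVariationalHodgeFor_of_seedOn_weilType hF hT hW e haQ ha0 hwW hwQ hw0 hSeed).2 n (by omega) hnN A φ hA hφ
    c hcW hc hnn

/-- **The companions' hypothesis implies this file's**: cofinal HYPERBOLIC seeds (p5 ∕ p11 g0's (S4)-shape clause) give cofinal seeded
Weil-type members, so every consequence below also follows from `S4Conjecture`-type hypotheses of `StructureLadderG2n.lean` — the new
statements are the WEAKER-hypothesis forms (object side), over the by-similitude reach fact. [cite: Deligne1982HodgeCycles, proof of Thm. 4.8 with Prop. 4.4]
[cite: vanGeemen1994HodgeAV, Lemma 5.2 (1)] -/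
theorem cofinalSeededMembers_of_cofinalHyperbolicSeedsOn
    (hS : ∀ n : ℕ, 2 ≤ n → ∀ d : ℕ, 0 < d → ∃ N : ℕ, n < N ∧ HasHyperbolicSeedOn 𝒪 N d) :
    ∀ n : ℕ, 2 ≤ n → ∀ d : ℕ, 0 < d → ∃ (N : ℕ) (P : AbelianVariety ℂ) (ψ₀ : P ⟶ P) (e : ProjectiveEmbedding P.X)
      (a : complexBetti (projectiveSpace e.n ℂ) 2) (w : complexBetti P.X (2 * N)),
      n < N ∧ IsWeilType P ψ₀ N d ∧ IsRationalClass a ∧ a ≠ 0 ∧ w ∈ weilClassesOf P ψ₀ N d ∧ IsRationalClass w ∧ w ≠ 0 ∧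
        HasSeedOn 𝒪 N P (symmetrisedClass d P ψ₀ e a) w := by
  intro n hn d hd
  obtain ⟨N, hnN, hSN⟩ := hS n hn d hd
  obtain ⟨P, ψ₀, e, a, w, h⟩ := hasSeededWeilTypeMember_of_hasHyperbolicSeedOn (by omega) hd hSN
  exact ⟨N, P, ψ₀, e, a, w, hnN, h⟩

/-- **STRUCTURE (S4) in seat p10's spelling `S4Conjecture E := E 5 ∧ ∀ n ≥ 6, n % 4 = 2 → E n`, with the kernel existence predicate read on
ANY component**: `E N := ∀ d > 0, SOME seeded Weil-type (N, d) member` (split or not) instead of p11 g0's `∀ d > 0, HasHyperbolicSeedOn 𝒪 N d`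
(`StructureLadderG2n.weilClassesImaginaryQuadratic_of_s4Conjecture_of_reach_of_localVariationalHodgeFor`). The levels `N ≡ 2 (mod 4)`, `N ≥ 6`,
are cofinal, so (S4)-on-any-component ∧ reach-by-similitude ∧ `LocalVariationalHodgeFor 𝒪` ⟹ R∞. (S4) is the structure's OPEN conjecture —
nothing is claimed; in STRUCTURE's words the existence clause may now be witnessed off the split component `(n, K, (−1)ⁿ·Nm)`. NOT `HC_AV`.
[cite: Weil1977HodgeRing, §3] [cite: Markman2025SurveySecant, §4 and §12 (preprint)] [cite: Schoen1998HodgeWeilAddendum, 10 (Proposition), p. 332] -/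
theorem weilClassesImaginaryQuadratic_of_s4Conjecture_seededMembers_of_reach_of_localVariationalHodgeFor
    (hF : weilFamilyReach_similar) (hT : LocalVariationalHodgeFor 𝒪)
    (hS4 : S4Conjecture fun N ↦ ∀ d : ℕ, 0 < d → ∃ (P : AbelianVariety ℂ) (ψ₀ : P ⟶ P) (e : ProjectiveEmbedding P.X)
      (a : complexBetti (projectiveSpace e.n ℂ) 2) (w : complexBetti P.X (2 * N)),
      IsWeilType P ψ₀ N d ∧ IsRationalClass a ∧ a ≠ 0 ∧ w ∈ weilClassesOf P ψ₀ N d ∧ IsRationalClass w ∧ w ≠ 0 ∧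
        HasSeedOn 𝒪 N P (symmetrisedClass d P ψ₀ e a) w) :
    WeilClassesImaginaryQuadratic :=
  weilClassesImaginaryQuadratic_of_reach_of_localVariationalHodgeFor_of_cofinalSeededMembers hF hT fun n hn d hd ↦ by
    obtain ⟨P, ψ₀, e, a, w, h⟩ := hS4.2 (4 * n + 2) (by omega) (by omega) d hd
    exact ⟨4 * n + 2, P, ψ₀, e, a, w, by omega, h⟩

end Cofinal

/-! ## §3 Terminus: seat p5's «consequences» tower from cofinal seeded members (Moonen–Zarhin BY NAME for dim ≤ 5); NOT `HC_AV` -/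

section Terminus

variable {𝒪 : ObjClass}

/-- **R1 = stmt-2524 `WeilSixfolds` and R1′ `NonsplitSixfolds` ⟸ reach-by-similitude ∧ `LocalVariationalHodgeFor 𝒪` ∧ ONE seeded
Weil-type member at level `4` for every `d` — on ANY ℚ(√-d)-Weil EIGHTFOLD component, split or not** (p5's
`nonsplitSixfolds_of_reach_of_localVariationalHodgeFor_of_hyperbolicSeedsOn_four` needs a SPLIT eightfold and the hyperbolic reach). The level-4
seed gives `WeilAlgebraicAll 3 d` (§1), i.e. item stmt-2524 read over the Literature Weil plane (`weilSixfolds_iff_weilClassesOf`), and R1′ is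
its non-split half (`nonsplitSixfolds_of_weilSixfolds`). The DECIDING g = 8 rows of the census are exactly searches for such members; the signed
verdict records none («NO-in-families-tried»). [cite: Markman2025SurveySecant, §11.5 Step 2 and §12 (preprint)]
[cite: Schoen1998HodgeWeilAddendum, 10 (Proposition), p. 332] [cite: Deligne1982HodgeCycles, proof of Thm. 4.8] -/
theorem weilSixfolds_and_nonsplitSixfolds_of_reach_of_localVariationalHodgeFor_of_seededMembers_four
    (hF : weilFamilyReach_similar) (hT : LocalVariationalHodgeFor 𝒪)
    (hS : ∀ d : ℕ, 0 < d → ∃ (P : AbelianVariety ℂ) (ψ₀ : P ⟶ P) (e : ProjectiveEmbedding P.X)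
      (a : complexBetti (projectiveSpace e.n ℂ) 2) (w : complexBetti P.X (2 * 4)),
      IsWeilType P ψ₀ 4 d ∧ IsRationalClass a ∧ a ≠ 0 ∧ w ∈ weilClassesOf P ψ₀ 4 d ∧ IsRationalClass w ∧ w ≠ 0 ∧
        HasSeedOn 𝒪 4 P (symmetrisedClass d P ψ₀ e a) w) :
    Theses.SevenfoldWeilCensus.WeilSixfolds ∧ NonsplitSixfolds := by
  have h3 : ∀ d : ℕ, 0 < d → WeilAlgebraicAll 3 d := fun d hd ↦ by
    obtain ⟨P, ψ₀, e, a, w, hW, haQ, ha0, hwW, hwQ, hw0, hSeed⟩ := hS d hd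
    exact (below_of_localVariationalHodgeFor_of_seedOn_weilType hF hT hW e haQ ha0 hwW hwQ hw0 hSeed).2 3 three_pos (by norm_num)
  have hR1 : Theses.SevenfoldWeilCensus.WeilSixfolds :=
    weilSixfolds_iff_weilClassesOf.2 fun d hd A φ hA _ hφ c hc hH hcW ↦ h3 d hd A φ hA hφ c hcW hc hH
  exact ⟨hR1, nonsplitSixfolds_of_weilSixfolds hR1⟩

/-- **F1 (Markman's FOURFOLD statement `Markman2025_weilClasses_algebraic_abelianFourfold`, re-derived) and — Moonen–Zarhin BY NAME — HC(dim ≤ 5)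
(`SevenfoldWeilCensus.HodgeAbelianDimLeFive`, [Mar25b] Cor. 1.3 AS PRINTED, as an implication) ⟸ reach-by-similitude ∧ `LocalVariationalHodgeFor 𝒪` ∧ ONE
seeded Weil-type member of ANY ℚ(√-d)-Weil SIXFOLD component for every `d`** (p5's `hodgeAbelianDimLeFive_of_moonenZarhin_…_hyperbolicSeedsOn_three`
needs a SPLIT sixfold per `d`). NOT a new case — the fourfold statement is in print ([Markman2025SurveySecant] Thm. 1.2) and the split sixfold objects
exist in print ([Markman2025SecantWeil] Thm. 1.5.1, preprint); this is the weaker-hypothesis form of the same implication (a deciding g = 6 row would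
also have served). [cite: Markman2025SurveySecant, Thm. 1.2, Cor. 1.3 and §11.5 Step 2 (preprint)] [cite: MoonenZarhin1999LowDim, Thm. 0.1 and Thm. 0.2]
[cite: Schoen1998HodgeWeilAddendum, 10 (Proposition), p. 332] -/
theorem floorFourfolds_and_dimLeFive_of_moonenZarhin_of_reach_of_localVariationalHodgeFor_of_seededMembers_three
    (hMZ : MoonenZarhin1999_hodgeClasses_abelian_dim_le_five_of_weilClassesFourfolds) (hF : weilFamilyReach_similar)
    (hT : LocalVariationalHodgeFor 𝒪)
    (hS : ∀ d : ℕ, 0 < d → ∃ (P : AbelianVariety ℂ) (ψ₀ : P ⟶ P) (e : ProjectiveEmbedding P.X)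
      (a : complexBetti (projectiveSpace e.n ℂ) 2) (w : complexBetti P.X (2 * 3)),
      IsWeilType P ψ₀ 3 d ∧ IsRationalClass a ∧ a ≠ 0 ∧ w ∈ weilClassesOf P ψ₀ 3 d ∧ IsRationalClass w ∧ w ≠ 0 ∧
        HasSeedOn 𝒪 3 P (symmetrisedClass d P ψ₀ e a) w) :
    Markman2025_weilClasses_algebraic_abelianFourfold ∧ Theses.SevenfoldWeilCensus.HodgeAbelianDimLeFive := by
  have h2 : ∀ d : ℕ, 0 < d → WeilAlgebraicAll 2 d := fun d hd ↦ by
    obtain ⟨P, ψ₀, e, a, w, hW, haQ, ha0, hwW, hwQ, hw0, hSeed⟩ := hS d hd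
    exact (below_of_localVariationalHodgeFor_of_seedOn_weilType hF hT hW e haQ ha0 hwW hwQ hw0 hSeed).2 2 two_pos (by norm_num)
  have hF1 : Markman2025_weilClasses_algebraic_abelianFourfold :=
    fun d hd A φ hA _ hφ c hc h22 hcW ↦ h2 d hd A φ hA hφ c hcW hc h22
  exact ⟨hF1, hMZ hF1⟩

/-- **What cofinal seeded members (ANY components) give in the tree: R∞ ∧ F1 (Markman's fourfold statement, re-derived) ∧ R1 = stmt-2524
`WeilSixfolds` ∧ R1′ `NonsplitSixfolds` ∧ R2 `SplitWeilAbelianVarieties` ∧ (Moonen–Zarhin BY NAME) HC(dim ≤ 5)** ([Mar25b] Cor. 1.3 AS PRINTED,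
as an implication) — seat p5's tower `ladder_of_moonenZarhin_of_reach_of_localVariationalHodgeFor_of_cofinalHyperbolicSeedsOn` with the
existence clause moved from split anchors to arbitrary Weil-type members and the reach fact in by-similitude form; the ring-2 ladder's ON-PATH
arrows from R∞ (`WeilTypeLadderOnPath`: `floorFourfolds_of_…`, `weilSixfolds_of_…`, `nonsplitSixfolds_of_…`, `splitWeilAbelianVarieties_of_…`,
`floorDimLeFive_of_…_of_moonenZarhin`) BY NAME — the same arrows p5's Tower §4 composes.
The CM-field rung and `HC_AV` are NOT reached (no descent edge over CM fields of degree > 2, no Weil-classes-to-`HC_AV` edge).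
[cite: Markman2025SurveySecant, Thm. 1.2, Cor. 1.3 and §12 (preprint)] [cite: MoonenZarhin1999LowDim, Thm. 0.1 and Thm. 0.2]
[cite: Weil1977HodgeRing, §3] [cite: Schoen1998HodgeWeilAddendum, 10 (Proposition), p. 332] -/
theorem ladder_of_moonenZarhin_of_reach_of_localVariationalHodgeFor_of_cofinalSeededMembers
    (hMZ : MoonenZarhin1999_hodgeClasses_abelian_dim_le_five_of_weilClassesFourfolds) (hF : weilFamilyReach_similar)
    (hT : LocalVariationalHodgeFor 𝒪)
    (hS : ∀ n : ℕ, 2 ≤ n → ∀ d : ℕ, 0 < d → ∃ (N : ℕ) (P : AbelianVariety ℂ) (ψ₀ : P ⟶ P) (e : ProjectiveEmbedding P.X)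
      (a : complexBetti (projectiveSpace e.n ℂ) 2) (w : complexBetti P.X (2 * N)),
      n < N ∧ IsWeilType P ψ₀ N d ∧ IsRationalClass a ∧ a ≠ 0 ∧ w ∈ weilClassesOf P ψ₀ N d ∧ IsRationalClass w ∧ w ≠ 0 ∧
        HasSeedOn 𝒪 N P (symmetrisedClass d P ψ₀ e a) w) :
    WeilClassesImaginaryQuadratic ∧ Markman2025_weilClasses_algebraic_abelianFourfold ∧ Theses.SevenfoldWeilCensus.WeilSixfolds ∧
      NonsplitSixfolds ∧ SplitWeilAbelianVarieties ∧ Theses.SevenfoldWeilCensus.HodgeAbelianDimLeFive := by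
  have hR := weilClassesImaginaryQuadratic_of_reach_of_localVariationalHodgeFor_of_cofinalSeededMembers hF hT hS
  exact ⟨hR, floorFourfolds_of_weilClassesImaginaryQuadratic hR, weilSixfolds_of_weilClassesImaginaryQuadratic hR,
    nonsplitSixfolds_of_weilClassesImaginaryQuadratic hR, splitWeilAbelianVarieties_of_weilClassesImaginaryQuadratic hR,
    floorDimLeFive_of_weilClassesImaginaryQuadratic_of_moonenZarhin hMZ hR⟩

end Terminus

section RouteC

variable (C : ChernCharacterBetti)

/-- **Route (C), rank door: cofinal seeded members of the real rank class ⟹ R∞** (`weilFamilyReach_similar` BY NAME; p4's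
`PerfectComplexRankTransfer C` BY NAME — ASSUMPTION, F-1; seeds of `rankObjClass C`, i.e. rank-admissible bounded complexes of vector bundles
with Markman's class shape on ANY Weil-type member, BY VALUE). [cite: BuchweitzFlenner2008HH, Prop. 6.4.4] [cite: Weil1977HodgeRing, §3]
[cite: Schoen1998HodgeWeilAddendum, 10 (Proposition), p. 332] -/
theorem weilClassesImaginaryQuadratic_of_reach_of_perfectComplexRankTransfer_of_cofinalSeededMembers (hF : weilFamilyReach_similar)
    (hT : PerfectComplexRankTransfer C)
    (hS : ∀ n : ℕ, 2 ≤ n → ∀ d : ℕ, 0 < d → ∃ (N : ℕ) (P : AbelianVariety ℂ) (ψ₀ : P ⟶ P) (e : ProjectiveEmbedding P.X)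
      (a : complexBetti (projectiveSpace e.n ℂ) 2) (w : complexBetti P.X (2 * N)),
      n < N ∧ IsWeilType P ψ₀ N d ∧ IsRationalClass a ∧ a ≠ 0 ∧ w ∈ weilClassesOf P ψ₀ N d ∧ IsRationalClass w ∧ w ≠ 0 ∧
        HasSeedOn (rankObjClass C) N P (symmetrisedClass d P ψ₀ e a) w) :
    WeilClassesImaginaryQuadratic :=
  weilClassesImaginaryQuadratic_of_reach_of_localVariationalHodgeFor_of_cofinalSeededMembers hF hT.localVariationalHodgeFor hS

/-- **Route (C), σ-door: cofinal seeded members of the real σ-class ⟹ R∞** (t-7's `PerfectComplexSigmaTransfer C` BY NAME — ASSUMPTION;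
seeds of `sigmaObjClass C`, i.e. `I`-semiregular strictly perfect complexes with Markman's class shape on ANY Weil-type member, BY VALUE).
[claim: Perry2026Semiregularity, status: under-review] [cite: BuchweitzFlenner2003, Def. 4.1 and §5 (I-semiregular)] [cite: Weil1977HodgeRing, §3] -/
theorem weilClassesImaginaryQuadratic_of_reach_of_perfectComplexSigmaTransfer_of_cofinalSeededMembers (hF : weilFamilyReach_similar)
    (hT : PerfectComplexSigmaTransfer C)
    (hS : ∀ n : ℕ, 2 ≤ n → ∀ d : ℕ, 0 < d → ∃ (N : ℕ) (P : AbelianVariety ℂ) (ψ₀ : P ⟶ P) (e : ProjectiveEmbedding P.X)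
      (a : complexBetti (projectiveSpace e.n ℂ) 2) (w : complexBetti P.X (2 * N)),
      n < N ∧ IsWeilType P ψ₀ N d ∧ IsRationalClass a ∧ a ≠ 0 ∧ w ∈ weilClassesOf P ψ₀ N d ∧ IsRationalClass w ∧ w ≠ 0 ∧
        HasSeedOn (sigmaObjClass C) N P (symmetrisedClass d P ψ₀ e a) w) :
    WeilClassesImaginaryQuadratic :=
  weilClassesImaginaryQuadratic_of_reach_of_localVariationalHodgeFor_of_cofinalSeededMembers hF hT.localVariationalHodgeFor hS

end RouteC

/-! ## §4 ONE REACH FACT: the companions' split-anchored sentences over `weilFamilyReach_similar` alone -/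

section OneReachFact

variable {𝒪 : ObjClass}

/-- **p7 ∕ p11 g0's level-`N` SPLIT-anchored ladder over the by-similitude reach**: BY NAME `weilFamilyReach_similar` (via
`weilFamilyReach_hyperbolic_of_similar`) and `LocalVariationalHodgeFor 𝒪`; BY VALUE ONE hyperbolic seed of class `𝒪` at level `N ≥ 1` for `ℚ(√-d)` ⟹
every split ℚ(√−d)-Weil `2N`-fold (`Stubs.WeilAlgebraicSplitHyperplane N d`) ∧ `WeilAlgebraicAll n d` for every `2 ≤ n < N`
(`AmplificationChainAssembly.splitHyperplane_…` ∕ `weilAlgebraicAll_…_hyperbolicSeedOn_lt`, unchanged). [cite: Deligne1982HodgeCycles, §4 Cor. 4.2 and proof of Thm. 4.8]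
[cite: Schoen1998HodgeWeilAddendum, §10] [cite: Markman2025SurveySecant, §11.5 Steps 1–2 (preprint)] -/
theorem splitLadder_of_reachSimilar_of_localVariationalHodgeFor_of_hyperbolicSeedOn (hF : weilFamilyReach_similar)
    (hT : LocalVariationalHodgeFor 𝒪) {N d : ℕ} (hN : 1 ≤ N) (hd : 0 < d) (hS : HasHyperbolicSeedOn 𝒪 N d) :
    Stubs.WeilAlgebraicSplitHyperplane N d ∧ ∀ n : ℕ, 2 ≤ n → n < N → WeilAlgebraicAll n d :=
  ⟨splitHyperplane_of_reach_of_localVariationalHodgeFor_of_hyperbolicSeedOn (weilFamilyReach_hyperbolic_of_similar hF) hN hd hT hS,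
    fun _ hn hnN ↦
      weilAlgebraicAll_of_localVariationalHodgeFor_of_hyperbolicSeedOn_lt (weilFamilyReach_hyperbolic_of_similar hF) hT hS hn hnN hd⟩

/-- **p11 g0's § g = 8 conjunction over the by-similitude reach** (`StructureLadderG2n.g8_noInFamiliesTried_and_conditional`, unchanged statement,
hypothesis `weilFamilyReach_hyperbolic` replaced by `weilFamilyReach_similar`). [bookkeeping ∧ cite: Deligne1982HodgeCycles, §4 Cor. 4.2 and proof of Thm. 4.8]
[cite: Schoen1998HodgeWeilAddendum, §10] -/
theorem g8_noInFamiliesTried_and_conditional_of_reachSimilar (hF : weilFamilyReach_similar) (hT : LocalVariationalHodgeFor 𝒪) :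
    CensusG8.outcome CensusG8.census = .noInFamiliesTried ∧
      ∀ d : ℕ, 0 < d → HasHyperbolicSeedOn 𝒪 4 d →
        Stubs.WeilAlgebraicSplitHyperplane 4 d ∧ WeilAlgebraicAll 3 d ∧ WeilAlgebraicAll 2 d ∧
          ∀ δ : weilNormResidueGroup d, WeilClassesComponent 3 d δ :=
  g8_noInFamiliesTried_and_conditional (weilFamilyReach_hyperbolic_of_similar hF) hT

/-- **p11 g0's (S4) reading over the by-similitude reach** (`StructureLadderG2n.weilClassesImaginaryQuadratic_of_s4Conjecture_of_reach_of_localVariationalHodgeFor`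
with `weilFamilyReach_similar`): (S4) in p10's spelling with SPLIT seeds ⟹ R∞. [cite: Weil1977HodgeRing, §3] [cite: Markman2025SurveySecant, §4 and §12 (preprint)]
[cite: Deligne1982HodgeCycles, §4 Cor. 4.2 and proof of Thm. 4.8] -/
theorem weilClassesImaginaryQuadratic_of_s4Conjecture_of_reachSimilar_of_localVariationalHodgeFor (hF : weilFamilyReach_similar)
    (hT : LocalVariationalHodgeFor 𝒪) (hS4 : S4Conjecture fun N ↦ ∀ d : ℕ, 0 < d → HasHyperbolicSeedOn 𝒪 N d) :
    WeilClassesImaginaryQuadratic :=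
  weilClassesImaginaryQuadratic_of_s4Conjecture_of_reach_of_localVariationalHodgeFor (weilFamilyReach_hyperbolic_of_similar hF) hT hS4

/-- **Seat p5's «consequences» tower over the by-similitude reach** (`MarkmanClassStatementTower.ladder_of_moonenZarhin_…_cofinalHyperbolicSeedsOn`,
unchanged statement, one reach fact): Moonen–Zarhin BY NAME, `weilFamilyReach_similar`, `LocalVariationalHodgeFor 𝒪`, cofinal HYPERBOLIC seeds ⟹
R∞ ∧ F1 ∧ R1 ∧ R1′ ∧ R2 ∧ HC(dim ≤ 5). (Also a corollary of §3 via `cofinalSeededMembers_of_cofinalHyperbolicSeedsOn`.) NOT `HC_AV`.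
[cite: Markman2025SurveySecant, Thm. 1.2, Cor. 1.3 and §12 (preprint)] [cite: MoonenZarhin1999LowDim, Thm. 0.1 and Thm. 0.2]
[cite: Deligne1982HodgeCycles, §4 Cor. 4.2 and proof of Thm. 4.8] -/
theorem ladder_of_moonenZarhin_of_reachSimilar_of_localVariationalHodgeFor_of_cofinalHyperbolicSeedsOn
    (hMZ : MoonenZarhin1999_hodgeClasses_abelian_dim_le_five_of_weilClassesFourfolds) (hF : weilFamilyReach_similar)
    (hT : LocalVariationalHodgeFor 𝒪) (hS : ∀ n : ℕ, 2 ≤ n → ∀ d : ℕ, 0 < d → ∃ N : ℕ, n < N ∧ HasHyperbolicSeedOn 𝒪 N d) :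
    WeilClassesImaginaryQuadratic ∧ Markman2025_weilClasses_algebraic_abelianFourfold ∧ Theses.SevenfoldWeilCensus.WeilSixfolds ∧
      NonsplitSixfolds ∧ SplitWeilAbelianVarieties ∧ Theses.SevenfoldWeilCensus.HodgeAbelianDimLeFive :=
  ladder_of_moonenZarhin_of_reach_of_localVariationalHodgeFor_of_cofinalHyperbolicSeedsOn hMZ (weilFamilyReach_hyperbolic_of_similar hF) hT hS

end OneReachFact

/-! ## §5 BEYOND DIMENSION 5: the GENERAL members of every component (van Geemen Thm. 6.12, ring 2 kernel theorems; s4-bridge-3's (B3-e)) -/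

section GeneralMembers

variable {𝒪 : ObjClass}

/-- **A seeded member of ANY component ⟹ the Hodge conjecture for every GENERAL Weil-type member of that component and of every component
below** (`HodgeGeneralWeilTypeComponent`: `HodgeConjectureFor A.dim A.X` for every member whose special Mumford–Tate group at the class is `SU_H`,
`HasHodgeGroupSU` — van Geemen Thm. 6.11–6.12, Weil 1977; ring 2's binder-free `hodgeGeneralWeilTypeComponent_of_weilClassesComponent_discharged`,
the arrow s4-bridge-3's (B3-e) `S4Bridge.hodgeGeneralWeilType_of_weilClassesComponent` re-exposes under the cell's name). BY NAME `weilFamilyReach_similar`, `LocalVariationalHodgeFor 𝒪`; BY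
VALUE the seeded member of `ComponentLadderG2n` §2. NOT the special members (`Hg ⊊ SU_H`), NOT `HC_AV`; nothing instantiated.
[cite: vanGeemen1994HodgeAV, Thm. 6.11–6.12 and Lemma 5.2] [cite: Weil1977HodgeRing, §3] [cite: Schoen1998HodgeWeilAddendum, 10 (Proposition), p. 332] -/
theorem hodgeGeneralWeilTypeComponents_of_reach_of_localVariationalHodgeFor_of_seedOn_member (hF : weilFamilyReach_similar)
    (hT : LocalVariationalHodgeFor 𝒪) {N d : ℕ} {δ : weilNormResidueGroup d}
    {P : AbelianVariety ℂ} {ψ₀ : P ⟶ P} (hW : IsWeilType P ψ₀ N d) (e : ProjectiveEmbedding P.X)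
    {a : complexBetti (projectiveSpace e.n ℂ) 2} (haQ : IsRationalClass a) (ha0 : a ≠ 0)
    (hδ : HasWeilDiscriminantNondeg P ψ₀ N d (symmetrisedClass d P ψ₀ e a) δ)
    {w : complexBetti P.X (2 * N)} (hwW : w ∈ weilClassesOf P ψ₀ N d) (hwQ : IsRationalClass w) (hw0 : w ≠ 0)
    (hS : HasSeedOn 𝒪 N P (symmetrisedClass d P ψ₀ e a) w) :
    HodgeGeneralWeilTypeComponent N d δ ∧
      ∀ n : ℕ, 0 < n → n < N → ∀ δ' : weilNormResidueGroup d, HodgeGeneralWeilTypeComponent n d δ' :=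
  have h := componentLadder_of_localVariationalHodgeFor_of_seedOn_member hF hT hW e haQ ha0 hδ hwW hwQ hw0 hS
  ⟨hodgeGeneralWeilTypeComponent_of_weilClassesComponent_discharged hW.pos hW.d_pos h.1,
    fun n hn hnN δ' ↦ hodgeGeneralWeilTypeComponent_of_weilClassesComponent_discharged hn hW.d_pos (h.2.1 n hn hnN δ')⟩

/-- **Cofinal seeded members on ANY components ⟹ the Hodge conjecture for EVERY GENERAL abelian variety of Weil type with imaginary quadratic
field, every dimension** (`Ring2Transport.HodgeGeneralWeilType`, van Geemen Thm. 6.12 for all `(n, d)`): §2's R∞ composed with ring 2's binder-free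
`hodgeGeneralWeilType_of_weilClassesImaginaryQuadratic_discharged`. The honest ceiling of the cell's strategy in the tree today: general members of
every component, NOT the special members, NOT CM fields of degree > 2, NOT `HC_AV`. Nothing is claimed — no cofinal supply of seeds exists.
[cite: vanGeemen1994HodgeAV, Thm. 4.11 and Thm. 6.11–6.12] [cite: Weil1977HodgeRing, §3] [cite: Markman2025SurveySecant, §1.1 Question 1.1 and §12 (preprint)] -/
theorem hodgeGeneralWeilType_of_reach_of_localVariationalHodgeFor_of_cofinalSeededMembers (hF : weilFamilyReach_similar)
    (hT : LocalVariationalHodgeFor 𝒪)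
    (hS : ∀ n : ℕ, 2 ≤ n → ∀ d : ℕ, 0 < d → ∃ (N : ℕ) (P : AbelianVariety ℂ) (ψ₀ : P ⟶ P) (e : ProjectiveEmbedding P.X)
      (a : complexBetti (projectiveSpace e.n ℂ) 2) (w : complexBetti P.X (2 * N)),
      n < N ∧ IsWeilType P ψ₀ N d ∧ IsRationalClass a ∧ a ≠ 0 ∧ w ∈ weilClassesOf P ψ₀ N d ∧ IsRationalClass w ∧ w ≠ 0 ∧
        HasSeedOn 𝒪 N P (symmetrisedClass d P ψ₀ e a) w) :
    Ring2Transport.HodgeGeneralWeilType :=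
  Ring2Transport.hodgeGeneralWeilType_of_weilClassesImaginaryQuadratic_discharged
    (weilClassesImaginaryQuadratic_of_reach_of_localVariationalHodgeFor_of_cofinalSeededMembers hF hT hS)

end GeneralMembers

/-! ## Audit: nothing is decided here
Every theorem with a Weil / Hodge conclusion carries among its hypotheses SEEDS (a seeded Weil-type member — the cell's computation targets,
now on ANY component) AND the transfer statement for the same class BY NAME (`LocalVariationalHodgeFor 𝒪`, or the venture's
`PerfectComplexRankTransfer C` ∕ `PerfectComplexSigmaTransfer C`), plus the refereed reach `weilFamilyReach_similar` — by §4 the ONLY reach fact of the assembly; §3 adds the Moonen–Zarhin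
reduction BY NAME; §5 adds ring 2's binder-free general-member theorems (van Geemen 6.12). The descent below the seed level is s4-bridge-2's Schoen ladder
(tree theorems, via `ComponentLadderG2n`). `HC_CM`, CM density, Mumford–Tate finiteness do not occur; NOT `HC_AV`. No definition, no named fact, no `sorry`. -/

end Summit.Ventures.HSemireg

end
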